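import Mathlib
import HarnessLib

/-!
# Non-square descent — A FINITELY GENERATED TORSION-FREE MODULE OF RANK ONE IS A LATTICE `E ↪ R` (input of the derived `hrank` / `hw`)
# for the seed crux `SignedMuSeedAtTwoPlus` stmt-BirchSwinnertonDyer-21438 (parent Kμ⁺ `SignedMuVanishingAtTwoPlus`
# stmt-BirchSwinnertonDyer-20689, route ResidualThetaTransportAtTwo), line card `Cruxes/SignedMuSeedAtTwoPlus/Lines/nonsquare-descent.md`

Cell `bsd-wall`, width seat `bsd-wall-rtt-p4-w2` g18 (`--supports`, closes nothing).  THEOREMS ONLY; BSD is not proved by this and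
nothing arithmetic is asserted: module algebra over a commutative domain.

The derived certificate inputs of this lane (`rank_le_one_modP_of_injective` in `Theorems/…NonsquareDescentRankOneModP.lean`,
`exists_nonTorsion_modP_of_ringHom` in `Theorems/…NonsquareDescentRankOneNonTorsion.lean`) are phrased for a LATTICE: an injective
`R`-linear map `ι : E → R` («`Ē^χ ↪ Λ'`»).  The line card's datum is «`rank_{Λ'} Ē^χ = 1`» for the finitely generated torsion-free
`Λ'`-module `Ē^χ` (stub S2 / S3 (c); hypothesis ledger of `Cruxes/SignedMuVanishingAtTwoPlus/NonsquareDescentKernel.md` §2).  This file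
closes the gap: **a finitely generated torsion-free module of rank `≤ 1` over a domain embeds `R`-linearly into `R`**, by the
common-denominator construction `A • e = ι(e) • e₀` (no fraction field needed).  Dictionary: `R = Λ'`, `E = Ē^χ`, `e₀` any non-zero
element (e.g. `u_∞` when `u_∞ ≠ 0`), `A` = product of the denominators of a generating set.

* §1 `exists_smul_eq_smul_of_rank_le_one` — rank `≤ 1` + torsion-free: every `e` has `a • e = c • e₀` with `a ≠ 0`;
  `smul_right_injective_of_torsionFree` — the coefficient `c` is unique.
* §2 **`exists_common_denominator`** — finite generation makes the denominator UNIFORM: `∃ A ≠ 0, ∀ e, ∃ c, A • e = c • e₀`.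
* §3 **`exists_injective_linearMap_of_rank_le_one`** — the embedding `ι : E →ₗ[R] R`, injective, with `ι e₀ = A ≠ 0` and the defining
  relation `A • e = ι e • e₀`; so every consequence of «`E ↪ R`» in this lane applies to «`Ē^χ` f.g. torsion-free of rank one».

[folklore]
-/

set_option autoImplicit false
-- the Theorems namespace of this sub repeats the summit name by design (D-0017 nested layout)
set_option linter.dupNamespace false

namespace Summit.BirchSwinnertonDyer.BirchSwinnertonDyer.Theorems.SignedMuAtTwo.NonsquareDescent

section Embedding

variable {R : Type*} [CommRing R] {E : Type*} [AddCommGroup E] [Module R E]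

/-! ## §1 One element at a time -/

/-- Rank `≤ 1` and torsion-free: every element `e` is commensurable with a fixed non-zero `e₀`, `a • e = c • e₀` with `a ≠ 0`.
[folklore] -/
theorem exists_smul_eq_smul_of_rank_le_one
    (htf : ∀ (a : R) (e : E), a ≠ 0 → a • e = 0 → e = 0)
    (hrank : ∀ v w : E, ∃ a b : R, (a ≠ 0 ∨ b ≠ 0) ∧ a • v + b • w = 0)
    {e₀ : E} (he₀ : e₀ ≠ 0) (e : E) :
    ∃ a c : R, a ≠ 0 ∧ a • e = c • e₀ := by
  obtain ⟨a, b, hab, h⟩ := hrank e e₀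
  have ha : a ≠ 0 := by
    rintro rfl
    rw [zero_smul, zero_add] at h
    rcases hab with h0 | hb
    · exact h0 rfl
    · exact he₀ (htf b e₀ hb h)
  exact ⟨a, -b, ha, by rw [neg_smul, eq_neg_iff_add_eq_zero, h]⟩

/-- Torsion-free: `c ↦ c • e₀` is injective for `e₀ ≠ 0`. [folklore] -/
theorem smul_right_injective_of_torsionFree
    (htf : ∀ (a : R) (e : E), a ≠ 0 → a • e = 0 → e = 0)
    {e₀ : E} (he₀ : e₀ ≠ 0) {c c' : R} (h : c • e₀ = c' • e₀) : c = c' := by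
  by_contra hne
  apply he₀ (htf (c - c') e₀ (sub_ne_zero.mpr hne) _)
  rw [sub_smul, h, sub_self]

/-! ## §2 A common denominator from finite generation -/

/-- **Common denominator.**  For `E` finitely generated, torsion-free of rank `≤ 1` and `e₀ ≠ 0` there is ONE `A ≠ 0` with
`A • e ∈ R • e₀` for every `e ∈ E` (product of the denominators of a finite generating set). [folklore] -/
theorem exists_common_denominator [IsDomain R] [Module.Finite R E]
    (htf : ∀ (a : R) (e : E), a ≠ 0 → a • e = 0 → e = 0)
    (hrank : ∀ v w : E, ∃ a b : R, (a ≠ 0 ∨ b ≠ 0) ∧ a • v + b • w = 0)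
    {e₀ : E} (he₀ : e₀ ≠ 0) :
    ∃ A : R, A ≠ 0 ∧ ∀ e : E, ∃ c : R, A • e = c • e₀ := by
  classical
  obtain ⟨s, hs⟩ := Module.Finite.fg_top (R := R) (M := E)
  have hgen : ∀ g : E, ∃ a : R, a ≠ 0 ∧ ∃ c : R, a • g = c • e₀ := fun g => by
    obtain ⟨a, c, ha, h⟩ := exists_smul_eq_smul_of_rank_le_one htf hrank he₀ g
    exact ⟨a, ha, c, h⟩
  choose a ha hc using hgen
  refine ⟨∏ g ∈ s, a g, Finset.prod_ne_zero_iff.mpr fun g _ => ha g, fun e => ?_⟩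
  have he : e ∈ Submodule.span R (s : Set E) := by rw [hs]; exact Submodule.mem_top
  induction he using Submodule.span_induction with
  | mem g hg =>
    obtain ⟨c, hcg⟩ := hc g
    refine ⟨(∏ g' ∈ s.erase g, a g') * c, ?_⟩
    rw [← Finset.prod_erase_mul s a (Finset.mem_coe.mp hg), mul_smul, hcg, ← mul_smul]
  | zero => exact ⟨0, by rw [smul_zero, zero_smul]⟩
  | add x y _ _ hx hy =>
    obtain ⟨c₁, h₁⟩ := hx
    obtain ⟨c₂, h₂⟩ := hy
    exact ⟨c₁ + c₂, by rw [smul_add, h₁, h₂, add_smul]⟩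
  | smul r x _ hx =>
    obtain ⟨c, h⟩ := hx
    exact ⟨r * c, by rw [smul_comm, h, ← mul_smul]⟩

/-! ## §3 The embedding -/

/-- **A finitely generated torsion-free module of rank `≤ 1` over a domain is a lattice `E ↪ R`.**  There is an injective `R`-linear
`ι : E → R` with `A • e = ι e • e₀` for all `e`, `ι e₀ = A ≠ 0` («`Ē^χ` f.g. torsion-free with `rank_{Λ'} Ē^χ = 1` ⇒ `Ē^χ ↪ Λ'`»; the image
is an ideal of `R`, of finite colength exactly when `E` is reflexive-up-to-finite — not needed here). [folklore] -/
theorem exists_injective_linearMap_of_rank_le_one [IsDomain R] [Module.Finite R E]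
    (htf : ∀ (a : R) (e : E), a ≠ 0 → a • e = 0 → e = 0)
    (hrank : ∀ v w : E, ∃ a b : R, (a ≠ 0 ∨ b ≠ 0) ∧ a • v + b • w = 0)
    {e₀ : E} (he₀ : e₀ ≠ 0) :
    ∃ (ι : E →ₗ[R] R) (A : R), Function.Injective ι ∧ A ≠ 0 ∧ ι e₀ = A ∧ ∀ e : E, A • e = ι e • e₀ := by
  classical
  obtain ⟨A, hA, hAe⟩ := exists_common_denominator htf hrank he₀
  choose c hc using hAe
  have huniq : ∀ (e : E) (c' : R), A • e = c' • e₀ → c e = c' := fun e c' h =>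
    smul_right_injective_of_torsionFree htf he₀ (by rw [← hc e, h])
  let ι : E →ₗ[R] R :=
    { toFun := c
      map_add' := fun x y => by
        apply huniq
        rw [smul_add, hc x, hc y, add_smul]
      map_smul' := fun r x => by
        apply huniq
        rw [RingHom.id_apply, smul_comm, hc x, smul_eq_mul, mul_smul] }
  refine ⟨ι, A, fun x y hxy => ?_, hA, huniq e₀ A rfl, fun e => hc e⟩
  have h1 : A • x = A • y := by
    change c x = c y at hxy
    rw [hc x, hc y, hxy]
  have h2 : A • (x - y) = 0 := by rw [smul_sub, h1, sub_self]
  exact sub_eq_zero.mp (htf A _ hA h2)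

/-- Packaged for the lane: a finitely generated torsion-free NON-ZERO module of rank `≤ 1` over a domain admits an injective `R`-linear map
to `R` — the hypothesis `ι, hι` of `rank_le_one_modP_of_injective` and `exists_nonTorsion_modP_of_ringHom`. [folklore] -/
theorem exists_injective_linearMap_of_rank_le_one' [IsDomain R] [Module.Finite R E]
    (htf : ∀ (a : R) (e : E), a ≠ 0 → a • e = 0 → e = 0)
    (hrank : ∀ v w : E, ∃ a b : R, (a ≠ 0 ∨ b ≠ 0) ∧ a • v + b • w = 0)
    (hE : ∃ e₀ : E, e₀ ≠ 0) :
    ∃ ι : E →ₗ[R] R, Function.Injective ι := by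
  obtain ⟨e₀, he₀⟩ := hE
  obtain ⟨ι, -, hι, -⟩ := exists_injective_linearMap_of_rank_le_one htf hrank he₀
  exact ⟨ι, hι⟩

end Embedding

end Summit.BirchSwinnertonDyer.BirchSwinnertonDyer.Theorems.SignedMuAtTwo.NonsquareDescent
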